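import Literature.Computability.AlgebraicComplexity.KroneckerPowEvaluation
import Literature.Computability.AlgebraicComplexity.AsymptoticRankScalarExtension
import HarnessLib

/-!
# The data of Pratt's algorithm: an integer decomposition of a power of `T_k`, in flat coordinates

Topic `Computability/AlgebraicComplexity`. Sixth instalment of the proof of
`Literature.Computability.AlgebraicComplexity.pratt2024_thm_1_9` (K. Pratt, STOC 2024, Thm. 1.9
[Pratt2024SCC], proof §2: "a constant-sized subset of the prime field of `𝔽` arising in a rank
decomposition of a fixed power of `T_k`"). The word RAM of the tree computes with `w`-bit words,
i.e. in `ℤ/2^w`; so instead of a prime field the verified algorithm uses an INTEGER decomposition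
(denominators cleared) and lets the machine arithmetic reduce it modulo `2^w` (`map_contractLevel`),
testing `= 0` at the end on a value of absolute size `< 2^w` (`abs_sum_ite_mul_le`).

* `exists_int_decomposition_of_rat` — clearing denominators: a decomposition of the rational
  tensor `t_ℚ` into `r` triads gives integer triads summing to `D³ · t` for some `D ≥ 1`;
* `blockEnum`, `blockOf`, `DigitDisjoint`, `AllDisjoint` — the flat coordinates of the algorithm:
  a natural `a < C^r` (`C = binom(3k,k)`) names the string of `k`-sets
  `blockOf k (digit C u a)`, `u < r`; `AllDisjoint k r a b c` says that the three strings are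
  blockwise pairwise disjoint, i.e. that `(a, b, c)` is in the support of `T_k^{⊗r}` (Pratt:
  "`T_k^{⊗r} = ∑_{(a,b,c) ∈ X³ : a ∨ b ∨ c = 1^{3rk}} X_a Y_b Z_c`");
* `kroneckerPow_tripartitionTensor_decode`, `prod_kroneckerPow_decode` — `T_k^{⊗m}` and
  `(T_k^{⊗m})^{⊗q}` on decoded flat indices are the indicators of `DigitDisjoint`/`AllDisjoint`
  (grouping digits in base `C^m` into digits in base `C`, `digit_digit_pow`);
* **`exists_pratt_data`** — for every `k` and `δ > 0`: a block length `m ≥ 1`, a number of triads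
  `R < (R̃_ℂ(T_k) + δ)^m`, a scale `D ≥ 1`, a bound `Amax` and integer tables `U V W : ℕ → ℕ → ℤ`
  (zero beyond `R`, entries bounded by `Amax`) with
  `∑_{i<R} U i d · V i e · W i f = D³ · [∀ t < m, DigitDisjoint k t d e f]` — the constants
  hard-wired into the program;
* **`pratt_evaluation_identity`** — with these tables, in any commutative ring, the sum over
  contraction strings of the products of the three last level tables (what the program computes,
  `KroneckerPowEvaluation`) equals `(D³)^q · ∑_{AllDisjoint k (q m) a b c} x a · y b · z c`;
* `abs_sum_ite_mul_le` — the size bound `≤ M³ B³` for such sums of bounded integers.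

## References

* [Pratt2024SCC] K. Pratt, *A stronger connection between the asymptotic rank conjecture and the
  set cover conjecture*, Proc. 56th STOC (2024), arXiv:2311.02774 — §1.1, §2 (proof of Thm. 1.9).
* [BurgisserClausenShokrollahi1997] P. Bürgisser, M. Clausen, M. A. Shokrollahi, *Algebraic
  Complexity Theory*, Springer 1997 — Prop. (15.17), Prop. (15.26).
-/

noncomputable section

namespace Literature.Computability.AlgebraicComplexity

open Finset

open scoped BigOperators

/-! ## Clearing denominators -/

section IntClearing

variable {ι κ μ : Type*} [Fintype ι] [Fintype κ] [Fintype μ]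

/-- A common denominator: the product of the denominators of finitely many rationals is a
positive natural divisible by each of them. [folklore] -/
theorem exists_common_denominator {α : Type*} [Fintype α] (f : α → ℚ) :
    ∃ D : ℕ, 0 < D ∧ ∀ a, (f a).den ∣ D := by
  refine ⟨∏ a, (f a).den, Finset.prod_pos fun a _ => (f a).den_pos, fun a => ?_⟩
  exact Finset.dvd_prod_of_mem (fun a => (f a).den) (Finset.mem_univ a)

/-- If `x.den ∣ D` then `D · x` is the integer `(D / x.den) · x.num`. [folklore] -/
theorem cast_div_den_mul_num {x : ℚ} {D : ℕ} (h : x.den ∣ D) :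
    ((D / x.den : ℕ) : ℚ) * (x.num : ℚ) = (D : ℚ) * x := by
  have hD : (D : ℚ) = ((D / x.den : ℕ) : ℚ) * (x.den : ℚ) := by
    rw [← Nat.cast_mul, Nat.div_mul_cancel h]
  rw [hD, mul_assoc, Rat.den_mul_eq_num]

/-- **Clearing denominators in a rational decomposition**: if the rational tensor `t_ℚ` of an
integer tensor `t` is a sum of `r` triads over `ℚ`, then `D³ · t` is a sum of `r` triads over `ℤ`
for some `D ≥ 1`. [folklore] -/
theorem exists_int_decomposition_of_rat (t : ι → κ → μ → ℤ) {r : ℕ} (w : Fin r → ι → ℚ)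
    (u : Fin r → κ → ℚ) (v : Fin r → μ → ℚ)
    (h : (fun a b c => ((t a b c : ℤ) : ℚ)) = ∑ i, triad (w i) (u i) (v i)) :
    ∃ D : ℕ, 0 < D ∧ ∃ (W : Fin r → ι → ℤ) (U : Fin r → κ → ℤ) (V : Fin r → μ → ℤ),
      (fun a b c => (D : ℤ) ^ 3 * t a b c) = ∑ i, triad (W i) (U i) (V i) := by
  classical
  -- one common denominator for all coordinates
  obtain ⟨D, hD, hdvd⟩ := exists_common_denominator
    (Sum.elim (fun p : Fin r × ι => w p.1 p.2)
      (Sum.elim (fun p : Fin r × κ => u p.1 p.2) (fun p : Fin r × μ => v p.1 p.2)))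
  have hw : ∀ i a, (w i a).den ∣ D := fun i a => hdvd (Sum.inl (i, a))
  have hu : ∀ i b, (u i b).den ∣ D := fun i b => hdvd (Sum.inr (Sum.inl (i, b)))
  have hv : ∀ i c, (v i c).den ∣ D := fun i c => hdvd (Sum.inr (Sum.inr (i, c)))
  refine ⟨D, hD, fun i a => ((D / (w i a).den : ℕ) : ℤ) * (w i a).num,
    fun i b => ((D / (u i b).den : ℕ) : ℤ) * (u i b).num,
    fun i c => ((D / (v i c).den : ℕ) : ℤ) * (v i c).num, ?_⟩
  funext a b c
  have hq : ((t a b c : ℤ) : ℚ) = ∑ i, w i a * u i b * v i c := by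
    simpa [sum_triad_apply] using congrFun (congrFun (congrFun h a) b) c
  apply Int.cast_injective (α := ℚ)
  rw [sum_triad_apply]
  simp only [Int.cast_mul, Int.cast_pow, Int.cast_natCast, Int.cast_sum,
    cast_div_den_mul_num (hw _ _), cast_div_den_mul_num (hu _ _), cast_div_den_mul_num (hv _ _),
    hq, Finset.mul_sum]
  refine Finset.sum_congr rfl fun i _ => ?_
  ring

end IntClearing

/-! ## Flat coordinates: strings of `k`-sets named by naturals -/

section Flat

/-- `C_k = binom(3k, k)`, the number of `k`-subsets of `[3k]` (the base of the flat coordinates).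
[cite: Pratt2024SCC, Def. 1.4] -/
abbrev prattC (k : ℕ) : ℕ := (3 * k).choose k

/-- `C_k > 0`. [folklore] -/
theorem prattC_pos (k : ℕ) : 0 < prattC k := Nat.choose_pos (by omega)

/-- A fixed enumeration of the `k`-subsets of `[3k]` by `[C_k]`. [folklore] -/
def blockEnum (k : ℕ) : Fin (prattC k) ≃ TripartitionIndex k :=
  ((Fintype.equivFin (TripartitionIndex k)).trans (finCongr (TripartitionIndex.card k))).symm

/-- The `k`-set with number `i` (read modulo `C_k`, so that this is total). [folklore] -/
def blockOf (k i : ℕ) : TripartitionIndex k :=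
  blockEnum k ⟨i % prattC k, Nat.mod_lt _ (prattC_pos k)⟩

/-- On `[C_k]` the numbering `blockOf` is the enumeration `blockEnum`. [folklore] -/
theorem blockOf_val (k : ℕ) (i : Fin (prattC k)) : blockOf k i = blockEnum k i := by
  unfold blockOf
  congr 1
  exact Fin.ext (Nat.mod_eq_of_lt i.2)

/-- Decoding a flat index into a string of `m` blocks: block `t` is the `k`-set numbered by digit
`t` in base `C_k`. [cite: Pratt2024SCC, §2 (proof of Thm. 1.9)] -/
def decodeBlocks (k m d : ℕ) : Fin m → TripartitionIndex k :=
  fun t => blockOf k (digit (prattC k) t d)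

/-- The support condition at one block: the `u`-th blocks of the three strings `a, b, c` are
pairwise disjoint (i.e. tripartition their copy of `[3k]`). [cite: Pratt2024SCC, §2 (proof of Thm. 1.9)] -/
def DigitDisjoint (k u a b c : ℕ) : Prop :=
  Disjoint (blockOf k (digit (prattC k) u a)).1 (blockOf k (digit (prattC k) u b)).1 ∧
    Disjoint (blockOf k (digit (prattC k) u a)).1 (blockOf k (digit (prattC k) u c)).1 ∧
    Disjoint (blockOf k (digit (prattC k) u b)).1 (blockOf k (digit (prattC k) u c)).1

/-- `DigitDisjoint` is decidable (finite sets). [folklore] -/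
instance (k u a b c : ℕ) : Decidable (DigitDisjoint k u a b c) := by
  unfold DigitDisjoint; infer_instance

/-- The support of `T_k^{⊗r}` in flat coordinates: all `r` blocks are pairwise disjoint (Pratt's
"`a ∨ b ∨ c = 1^{3rk}`" for `a, b, c ∈ X`). [cite: Pratt2024SCC, §2 (proof of Thm. 1.9)] -/
def AllDisjoint (k r a b c : ℕ) : Prop :=
  ∀ u, u < r → DigitDisjoint k u a b c

/-- `AllDisjoint` is decidable (bounded quantifier). [folklore] -/
instance (k r a b c : ℕ) : Decidable (AllDisjoint k r a b c) := by
  unfold AllDisjoint; infer_instance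

variable {S : Type*} [CommSemiring S]

/-- `T_k^{⊗m}` at decoded flat indices is the indicator of blockwise disjointness.
[cite: Pratt2024SCC, §2 (proof of Thm. 1.9)] -/
theorem kroneckerPow_tripartitionTensor_decode (k m d e f : ℕ) :
    kroneckerPow (tripartitionTensor S k) m (decodeBlocks k m d) (decodeBlocks k m e)
        (decodeBlocks k m f) =
      if ∀ t, t < m → DigitDisjoint k t d e f then 1 else 0 := by
  rw [kroneckerPow_apply]
  by_cases h : ∀ t, t < m → DigitDisjoint k t d e f
  · rw [if_pos h]
    refine Finset.prod_eq_one fun t _ => ?_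
    have h' := h t t.2
    unfold DigitDisjoint at h'
    exact tripartitionTensor_apply_of_disjoint S k h'.1 h'.2.1 h'.2.2
  · rw [if_neg h]
    push Not at h
    obtain ⟨t, ht, hne⟩ := h
    refine Finset.prod_eq_zero (Finset.mem_univ (⟨t, ht⟩ : Fin m)) ?_
    exact tripartitionTensor_apply_of_not S k hne

/-- Grouping: the inner condition at digit `s` in base `C^m` is the condition at the blocks
`s m, …, s m + m - 1`. [folklore] -/
theorem digitDisjoint_digit_pow (k m t s a b c : ℕ) (ht : t < m) :
    DigitDisjoint k t (digit (prattC k ^ m) s a) (digit (prattC k ^ m) s b)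
        (digit (prattC k ^ m) s c) ↔ DigitDisjoint k (s * m + t) a b c := by
  unfold DigitDisjoint
  rw [digit_digit_pow ht, digit_digit_pow ht, digit_digit_pow ht]

/-- All inner conditions at all outer digits `s < q` are all block conditions `u < q m`. [folklore] -/
theorem forall_digitDisjoint_iff (k m q a b c : ℕ) :
    (∀ s, s < q → ∀ t, t < m → DigitDisjoint k t (digit (prattC k ^ m) s a)
        (digit (prattC k ^ m) s b) (digit (prattC k ^ m) s c)) ↔ AllDisjoint k (q * m) a b c := by
  constructor
  · intro h u hu
    have hm : 0 < m := Nat.pos_of_ne_zero fun h0 => by subst h0; simp at hu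
    have h1 := h (u / m) ((Nat.div_lt_iff_lt_mul hm).2 hu) (u % m) (Nat.mod_lt _ hm)
    rw [digitDisjoint_digit_pow _ _ _ _ _ _ _ (Nat.mod_lt _ hm)] at h1
    rwa [Nat.div_add_mod'] at h1
  · intro h s hs t ht
    rw [digitDisjoint_digit_pow _ _ _ _ _ _ _ ht]
    exact h _ (mul_add_lt_mul hs ht)

/-- `(T_k^{⊗m})^{⊗q}` at decoded digits is the indicator of `AllDisjoint k (q m)`.
[cite: Pratt2024SCC, §2 (proof of Thm. 1.9)] -/
theorem prod_kroneckerPow_decode (k m q a b c : ℕ) :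
    ∏ s ∈ range q, kroneckerPow (tripartitionTensor S k) m
        (decodeBlocks k m (digit (prattC k ^ m) s a)) (decodeBlocks k m (digit (prattC k ^ m) s b))
        (decodeBlocks k m (digit (prattC k ^ m) s c)) =
      if AllDisjoint k (q * m) a b c then 1 else 0 := by
  simp only [kroneckerPow_tripartitionTensor_decode]
  by_cases hA : AllDisjoint k (q * m) a b c
  · rw [if_pos hA]
    refine Finset.prod_eq_one fun s hs => ?_
    rw [if_pos ((forall_digitDisjoint_iff k m q a b c).2 hA s (mem_range.1 hs))]
  · rw [if_neg hA]
    rw [← forall_digitDisjoint_iff] at hA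
    push Not at hA
    obtain ⟨s, hs, hnot⟩ := hA
    refine Finset.prod_eq_zero (mem_range.2 hs) ?_
    rw [if_neg]
    push Not
    exact hnot

end Flat

/-! ## The hard-wired data -/

section Data

/-- `T_k` over `ℚ` is the rational tensor of `T_k` over `ℤ` (entries `0`, `1`). [cite: Pratt2024SCC, Def. 1.4] -/
theorem tripartitionTensor_intCast (k : ℕ) :
    (fun S T U => ((tripartitionTensor ℤ k S T U : ℤ) : ℚ)) = tripartitionTensor ℚ k := by
  funext S T U
  simp only [tripartitionTensor_apply]
  split_ifs <;> simp

/-- Kronecker powers commute with the cast `ℤ → ℚ`. [folklore] -/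
theorem kroneckerPow_intCast {ι κ μ : Type*} (t : ι → κ → μ → ℤ) (m : ℕ) :
    kroneckerPow (fun a b c => ((t a b c : ℤ) : ℚ)) m =
      fun a b c => ((kroneckerPow t m a b c : ℤ) : ℚ) := by
  funext a b c
  simp only [kroneckerPow_apply, Int.cast_prod]

/-- **The data of Pratt's algorithm.** For every `k` and `δ > 0` there are: a block length
`m ≥ 1`, a number of triads `R` with `R < (R̃_ℂ(T_k) + δ)^m`, a scale `D ≥ 1`, a bound `Amax`,
and integer tables `U V W : ℕ → ℕ → ℤ`, zero at triad indices `≥ R` and bounded by `Amax` in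
absolute value, which decompose `D³ · T_k^{⊗m}` in flat coordinates:
`∑_{i<R} U i d · V i e · W i f = D³ · [∀ t < m, DigitDisjoint k t d e f]` for all `d, e, f`.
(Pratt: the "rank decomposition of a fixed power of `T_k`" over the prime field, here made
integral; from `exists_rat_decomposition_tripartitionTensor_pow`, BCS Prop. 15.17.)
[cite: Pratt2024SCC, §2 (proof of Thm. 1.9)] -/
theorem exists_pratt_data (k : ℕ) {δ : ℝ} (hδ : 0 < δ) :
    ∃ m : ℕ, 1 ≤ m ∧ ∃ R D : ℕ, 0 < D ∧
      (R : ℝ) < (asymptoticRank (tripartitionTensor ℂ k) + δ) ^ m ∧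
      ∃ (Amax : ℕ) (U V W : ℕ → ℕ → ℤ),
        (∀ i d, R ≤ i → U i d = 0 ∧ V i d = 0 ∧ W i d = 0) ∧
        (∀ i d, |U i d| ≤ Amax ∧ |V i d| ≤ Amax ∧ |W i d| ≤ Amax) ∧
        ∀ d e f, ∑ i ∈ range R, U i d * V i e * W i f =
          if ∀ t, t < m → DigitDisjoint k t d e f then (D : ℤ) ^ 3 else 0 := by
  classical
  obtain ⟨m, hm, r, w, u, v, hdec, hlt⟩ := exists_rat_decomposition_tripartitionTensor_pow k hδ
  -- clear denominators
  rw [← tripartitionTensor_intCast, kroneckerPow_intCast] at hdec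
  obtain ⟨D, hD, W', U', V', hint⟩ :=
    exists_int_decomposition_of_rat (kroneckerPow (tripartitionTensor ℤ k) m) w u v hdec
  -- flat tables (first tensor leg ↦ `U`, second ↦ `V`, third ↦ `W`)
  set U : ℕ → ℕ → ℤ := fun i d => if h : i < r then W' ⟨i, h⟩ (decodeBlocks k m d) else 0
    with hUdef
  set V : ℕ → ℕ → ℤ := fun i d => if h : i < r then U' ⟨i, h⟩ (decodeBlocks k m d) else 0
    with hVdef
  set W : ℕ → ℕ → ℤ := fun i d => if h : i < r then V' ⟨i, h⟩ (decodeBlocks k m d) else 0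
    with hWdef
  -- a global bound: finitely many values
  set vals : Finset ℤ :=
    (Finset.univ.image fun p : Fin r × (Fin m → TripartitionIndex k) => |W' p.1 p.2|) ∪
    (Finset.univ.image fun p : Fin r × (Fin m → TripartitionIndex k) => |U' p.1 p.2|) ∪
    (Finset.univ.image fun p : Fin r × (Fin m → TripartitionIndex k) => |V' p.1 p.2|)
    with hvals
  obtain ⟨B, hB⟩ : ∃ B : ℤ, ∀ z ∈ vals, z ≤ B := Finset.exists_le vals
  have hB0 : 0 ≤ B ⊔ 0 := le_sup_right
  refine ⟨m, hm, r, D, hD, hlt, (B ⊔ 0).toNat, U, V, W, ?_, ?_, ?_⟩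
  · intro i d hi
    simp only [hUdef, hVdef, hWdef, dif_neg (not_lt.2 hi), and_self]
  · have hle : ∀ z ∈ vals, z ≤ ((B ⊔ 0).toNat : ℤ) := fun z hz => by
      rw [Int.toNat_of_nonneg hB0]; exact (hB z hz).trans le_sup_left
    intro i d
    by_cases hi : i < r
    · simp only [hUdef, hVdef, hWdef, dif_pos hi]
      refine ⟨hle _ ?_, hle _ ?_, hle _ ?_⟩
      · exact Finset.mem_union_left _ (Finset.mem_union_left _
          (Finset.mem_image.2 ⟨(⟨i, hi⟩, decodeBlocks k m d), Finset.mem_univ _, rfl⟩))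
      · exact Finset.mem_union_left _ (Finset.mem_union_right _
          (Finset.mem_image.2 ⟨(⟨i, hi⟩, decodeBlocks k m d), Finset.mem_univ _, rfl⟩))
      · exact Finset.mem_union_right _
          (Finset.mem_image.2 ⟨(⟨i, hi⟩, decodeBlocks k m d), Finset.mem_univ _, rfl⟩)
    · simp only [hUdef, hVdef, hWdef, dif_neg hi, abs_zero]
      exact ⟨by positivity, by positivity, by positivity⟩
  · intro d e f
    have happ := congrFun (congrFun (congrFun hint (decodeBlocks k m d)) (decodeBlocks k m e))
      (decodeBlocks k m f)
    rw [sum_triad_apply, kroneckerPow_tripartitionTensor_decode] at happ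
    rw [Finset.sum_range (fun i => U i d * V i e * W i f)]
    simp only [hUdef, hVdef, hWdef, Fin.is_lt, dif_pos, Fin.eta]
    rw [← happ]
    split_ifs <;> simp

/-- **What the program computes.** With tables as in `exists_pratt_data`, in any commutative ring
(the machine: `ℤ/2^w`), the sum over all contraction strings `P < R^q` of the products of the three
last level tables (`KroneckerPowEvaluation.sum_contractLevel_mul_eq`) is
`(D³)^q · ∑_{a,b,c < (C^m)^q, AllDisjoint k (q m) a b c} x a · y b · z c` — `D^{3q}` times the
restriction of the trilinear form `T_k^{⊗ q m}` to the vectors `x, y, z`.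
[cite: Pratt2024SCC, §2 (proof of Thm. 1.9)] -/
theorem pratt_evaluation_identity {S : Type*} [CommRing S] (k m q R : ℕ) (D : ℕ)
    (U V W : ℕ → ℕ → ℤ)
    (hUVW : ∀ d e f, ∑ i ∈ range R, U i d * V i e * W i f =
      if ∀ t, t < m → DigitDisjoint k t d e f then (D : ℤ) ^ 3 else 0)
    (x y z : ℕ → S) :
    ∑ P ∈ range (R ^ q),
        contractLevel (prattC k ^ m) R q (fun i d => (U i d : S)) x q P 0 *
        contractLevel (prattC k ^ m) R q (fun i d => (V i d : S)) y q P 0 *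
        contractLevel (prattC k ^ m) R q (fun i d => (W i d : S)) z q P 0 =
      ((D : S) ^ 3) ^ q * ∑ a ∈ range ((prattC k ^ m) ^ q), ∑ b ∈ range ((prattC k ^ m) ^ q),
        ∑ c ∈ range ((prattC k ^ m) ^ q),
          if AllDisjoint k (q * m) a b c then x a * y b * z c else 0 := by
  rw [sum_contractLevel_mul_eq (prattC k ^ m) R q _ _ _
    (fun d e f => if ∀ t, t < m → DigitDisjoint k t d e f then ((D : S) ^ 3) else 0)
    (fun d e f _ _ _ => by
      have h := congrArg (fun z : ℤ => (z : S)) (hUVW d e f)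
      simp only [Int.cast_sum, Int.cast_mul, Int.cast_ite, Int.cast_pow, Int.cast_natCast,
        Int.cast_zero] at h
      exact h.symm)]
  rw [Finset.mul_sum]
  refine Finset.sum_congr rfl fun a _ => ?_
  rw [Finset.mul_sum]
  refine Finset.sum_congr rfl fun b _ => ?_
  rw [Finset.mul_sum]
  refine Finset.sum_congr rfl fun c _ => ?_
  by_cases hA : AllDisjoint k (q * m) a b c
  · rw [if_pos hA, Finset.prod_congr rfl (fun s hs =>
      if_pos ((forall_digitDisjoint_iff k m q a b c).2 hA s (mem_range.1 hs))),
      Finset.prod_const, Finset.card_range]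
  · rw [if_neg hA, mul_zero]
    rw [← forall_digitDisjoint_iff] at hA
    push Not at hA
    obtain ⟨s, hs, hnot⟩ := hA
    rw [Finset.prod_eq_zero (mem_range.2 hs), zero_mul]
    rw [if_neg]
    push Not
    exact hnot

/-- The size of such sums: `|∑_{a,b,c<M} [P a b c] x a y b z c| ≤ M³ B³` when the entries are
bounded by `B`. (With `x, y, z ∈ [0, 16)` and the scale `D^{3q}` this bounds the integer the machine
holds modulo `2^w`; the word size is chosen larger.) [folklore] -/
theorem abs_sum_ite_mul_le (M : ℕ) (P : ℕ → ℕ → ℕ → Prop) [∀ a b c, Decidable (P a b c)]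
    (x y z : ℕ → ℤ) {B : ℤ} (hx : ∀ a, |x a| ≤ B) (hy : ∀ b, |y b| ≤ B) (hz : ∀ c, |z c| ≤ B) :
    |∑ a ∈ range M, ∑ b ∈ range M, ∑ c ∈ range M, (if P a b c then x a * y b * z c else 0)| ≤
      (M : ℤ) ^ 3 * B ^ 3 := by
  have hB : 0 ≤ B := (abs_nonneg _).trans (hx 0)
  have h1 : ∀ a b c, |(if P a b c then x a * y b * z c else 0)| ≤ B ^ 3 := by
    intro a b c
    split_ifs
    · rw [abs_mul, abs_mul, pow_succ, pow_succ, pow_one]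
      exact mul_le_mul (mul_le_mul (hx a) (hy b) (abs_nonneg _) hB) (hz c) (abs_nonneg _)
        (mul_nonneg hB hB)
    · rw [abs_zero]; positivity
  calc |∑ a ∈ range M, ∑ b ∈ range M, ∑ c ∈ range M, (if P a b c then x a * y b * z c else 0)|
      ≤ ∑ a ∈ range M, ∑ b ∈ range M, ∑ c ∈ range M, B ^ 3 := by
        refine (Finset.abs_sum_le_sum_abs _ _).trans (Finset.sum_le_sum fun a _ => ?_)
        refine (Finset.abs_sum_le_sum_abs _ _).trans (Finset.sum_le_sum fun b _ => ?_)
        exact (Finset.abs_sum_le_sum_abs _ _).trans (Finset.sum_le_sum fun c _ => h1 a b c)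
    _ = (M : ℤ) ^ 3 * B ^ 3 := by
        simp only [Finset.sum_const, Finset.card_range]
        ring

end Data

end Literature.Computability.AlgebraicComplexity
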